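import Literature.Probability.Percolation.Isoradial
import Literature.Probability.Percolation.IsoradialArmUniversality
import Literature.Probability.LatticeModels.IsoradialSquareGrid
import Literature.Probability.LatticeModels.IsoradialGraphsProofs
import Literature.Probability.LatticeModels.IsoradialPercolationProofs
import HarnessLib

/-!
# Grimmett–Manolescu universality of the alternating-arm exponents: the two arm events

Topic `Literature/Probability/Percolation`; companion of `Isoradial.lean`, which vendors
Grimmett–Manolescu, *Bond percolation on isoradial graphs: criticality and universality*,
PTRF 159 (2014) 273–327 = arXiv:1204.0505, §3, Theorem "Universality" (a) for `π = ρ_{2j}`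
(`j ≥ 1`) as the named fact `gm_universality_arms`. Everything in this file is PROVED (no
`sorry`, no named fact, D-0026; the only definition is the explicit finite configuration
`ladderConfig` used as a witness). It records, by theorems, why the *original transcription* of
that fact (2026-08-15 verdict of its `provefact` seat: **misstated**, on two independent counts)
was not the statement of the source, and it compares the two arm events of the tree — the
prelude's `RhombicEmbedding.embArmEvent (alternatingColours j)` used by the original
transcription and the cluster-separated `RhombicEmbedding.embAltArmEvent j` of
`IsoradialArmUniversality` used by the corrected statement (the restatement in place of
`gm_universality_arms`, same name and cite, whose docstring `History` paragraph quotes the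
superseded body).

## D1 — the prelude's arm event is not the alternating one

The source (§3, definition of the arm events, arXiv p. 7): "the arm-event `A_σ(N, n)` is the
event that there exist `k` vertex-disjoint crossings `γ_1, …, γ_k` of `A(N, n)` with colours
`σ_i` **taken in anticlockwise order**"; "`σ` is called alternating if it has even length and
`σ = (1,0,1,0,…)` or `(0,1,0,1,…)`; when `σ` is alternating with length `k = 2j` the event is
denoted `A_{2j}(N, n)`", and Theorem "Universality" (a) is stated for
`π ∈ {ρ} ∪ {ρ_{2j} : j ≥ 1}` only; for general colour sequences the existence and invariance of
`ρ(σ, G)` is the paper's *Conjecture* (§3). The prelude's event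
`RhombicEmbedding.embArmEvent κ r R` (`IsoradialPercolation`), used by the original
transcription with `κ = alternatingColours j`, asks for `j` pairwise vertex-disjoint primal open
walks and `j` pairwise vertex-disjoint dual open walks across `Λ_R ∖ Λ_r` and imposes **no
cyclic order and no separation between arms of the same kind** (its docstring says so,
believing this "irrelevant … where colours alternate"). For `j ≥ 2` that event is the union,
over *all* colour patterns with `j` arms of each kind (e.g. primal, primal, dual, dual for
`j = 2`), of the corresponding polychromatic arm events: strictly larger than `A_{2j}`, and not
an event the source's theorem speaks about. The theorem
`exists_mem_embArmEvent_alternatingColours_two_of_connected` below makes this concrete on the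
isoradial square lattice `squareLatticeEmbedding` (`√2 ℤ²`): the "ladder" configuration (rails
`y = 0, 1` from `x = 1` to `x = 3`, one rung at `x = 2`, every other edge closed) lies in
`embArmEvent (alternatingColours 2) 2 3`, although all its open edges form ONE open cluster — so
any two open crossings of any annulus are joined by an open path (`…_crossings_connected`),
whereas two primal arms of GM's `A_4(N, n)` are separated, inside the annulus, by the two dual
arms between them and therefore lie in distinct open clusters of the annulus (this separated
form is the one the source itself works with: §8.2, the modified events `Ã_{2j}`,
"`x_i ↔ y_i` and `x_i ↮ x_{i'}` for `i ≠ i'`"). The star–triangle transport of §8.3–8.4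
preserves (non-)connection of clusters, not vertex-disjointness of arms inside one cluster, so
the printed proof does not cover the larger event either. For `j = 1` (one primal and one dual
arm) the two events agree.

## D2 — the square-grid hypothesis (shared with the sibling facts)

As recorded for `gm_universality_oneArm` in `IsoradialPrintedSGP.lean` (and in the docstring
of `RhombicEmbedding.HasSquareGridProperty`): the original transcription hypothesised the H21
rendering `HasSquareGridProperty`, strictly weaker than the printed SGP(I) of §4.2 (it drops
clause (b): every track outside a grid family meets every track of that family, in order),
both for `G` and for the witness `G₀`; each occurrence made the statement stronger than what
is printed. The faithful predicate is `RhombicEmbedding.HasSquareGridPropertyGM`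
(`IsoradialSquareGrid`).

## The two events compared, by theorems

* `RhombicEmbedding.embAltArmEvent_one_eq`: for every rhombic embedding,
  `embAltArmEvent 1 r R = embArmEvent (alternatingColours 1) r R` (one primal and one dual
  crossing; every separation or disjointness clause is vacuous) — so at `j = 1` (`π = ρ_2`) the
  original transcription and the corrected statement differ only in the square-grid
  hypothesis, the old body implying the new one through
  `HasSquareGridPropertyGM.hasSquareGridProperty`;
* `ladderConfig_mem_embArmEvent`, `ladderConfig_not_mem_embAltArmEvent` and
  `embAltArmEvent_two_ssubset_embArmEvent`: on `√2 ℤ²` the ladder configuration is in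
  `embArmEvent (alternatingColours 2) 2 3` but not in `embAltArmEvent 2 2 3`, so at `j = 2` the
  corrected event is a **strict** subset of the prelude's event on a graph of the class `𝒢` —
  D1 as a strict inclusion between the tree's two events; for `j ≥ 2` neither version of the
  statement implies the other.

(History: until the restatement this file also carried `gm_universality_arms.toGM_one` and
`gm_universality_arms.altArms_one`, deriving the `j = 1` case of the corrected statement from
the original body taken as hypothesis `(h : gm_universality_arms G emb ε)`; with the body
replaced they would be the `j = 1` instance of the fact itself, and were removed.)

## References

* G. R. Grimmett, I. Manolescu, *Bond percolation on isoradial graphs: criticality and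
  universality*, PTRF 159 (2014) 273–327 (arXiv:1204.0505): §3 (arm events `A_σ(N, n)`,
  "in anticlockwise order"; alternating sequences; Theorem "Universality" (a); Conjecture on
  general `σ`), §4.2 (SGP(I)), §8.1 (Proposition (exp_transport)), §8.2 (modified arm events
  `Ã_k`, Proposition (exp_equiv)), §8.3–8.4 (transport of arm events).
-/

noncomputable section

namespace Literature.Probability.Percolation

open LatticeModels Percolation

/-! ### The H21 event with alternating colours occurs on a single open cluster (D1) -/

section Witness

open RhombicEmbedding

/-- Sup-norm of a vertex of the isoradial square lattice `√2 ℤ²`, bounded above through its two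
lattice coordinates: `‖z x‖_∞ = √2 · max |x₀| |x₁|`. (Grimmett–Manolescu 2014, §1, boxes `Λ_n`;
elementary.) [folklore] -/
theorem boxNorm_squareLattice_z_le {x : Site 2} {t : ℝ} (h0 : |(x 0 : ℝ)| ≤ t)
    (h1 : |(x 1 : ℝ)| ≤ t) : (squareLatticeEmbedding.z x).boxNorm ≤ Real.sqrt 2 * t := by
  have hre : (squareLatticeEmbedding.z x).re = Real.sqrt 2 * (x 0 : ℝ) := by
    rw [squareLatticeEmbedding_z]; simp [Complex.mul_re]
  have him : (squareLatticeEmbedding.z x).im = Real.sqrt 2 * (x 1 : ℝ) := by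
    rw [squareLatticeEmbedding_z]; simp [Complex.mul_im]
  simp only [Complex.boxNorm, hre, him, abs_mul, abs_of_nonneg (Real.sqrt_nonneg 2)]
  exact max_le (mul_le_mul_of_nonneg_left h0 (Real.sqrt_nonneg 2))
    (mul_le_mul_of_nonneg_left h1 (Real.sqrt_nonneg 2))

/-- Sup-norm of a vertex of `√2 ℤ²`, bounded below through its first lattice coordinate.
(Grimmett–Manolescu 2014, §1; elementary.) [folklore] -/
theorem le_boxNorm_squareLattice_z {x : Site 2} {t : ℝ} (h0 : t ≤ |(x 0 : ℝ)|) :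
    Real.sqrt 2 * t ≤ (squareLatticeEmbedding.z x).boxNorm := by
  have hre : (squareLatticeEmbedding.z x).re = Real.sqrt 2 * (x 0 : ℝ) := by
    rw [squareLatticeEmbedding_z]; simp [Complex.mul_re]
  simp only [Complex.boxNorm, hre, abs_mul, abs_of_nonneg (Real.sqrt_nonneg 2)]
  exact le_max_of_le_left (mul_le_mul_of_nonneg_left h0 (Real.sqrt_nonneg 2))

/-- Sup-norm of a face centre of `√2 ℤ²` (the face with lower-left corner `f` is centred at
`√2 (f + (1 + i)/2)`), bounded above through the lattice coordinates.
(Grimmett–Manolescu 2014, §2.1, the square lattice; elementary.) [folklore] -/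
theorem boxNorm_squareLattice_c_le {f : Site 2} {t : ℝ} (h0 : |(f 0 : ℝ) + 1 / 2| ≤ t)
    (h1 : |(f 1 : ℝ) + 1 / 2| ≤ t) : (squareLatticeEmbedding.c f).boxNorm ≤ Real.sqrt 2 * t := by
  have hre : (squareLatticeEmbedding.c f).re = Real.sqrt 2 * ((f 0 : ℝ) + 1 / 2) := by
    rw [squareLatticeEmbedding_c]
    simp [Complex.mul_re, Complex.div_ofNat_re, Complex.div_ofNat_im]
  have him : (squareLatticeEmbedding.c f).im = Real.sqrt 2 * ((f 1 : ℝ) + 1 / 2) := by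
    rw [squareLatticeEmbedding_c]
    simp [Complex.mul_im, Complex.div_ofNat_re, Complex.div_ofNat_im]
  simp only [Complex.boxNorm, hre, him, abs_mul, abs_of_nonneg (Real.sqrt_nonneg 2)]
  exact max_le (mul_le_mul_of_nonneg_left h0 (Real.sqrt_nonneg 2))
    (mul_le_mul_of_nonneg_left h1 (Real.sqrt_nonneg 2))

/-- Sup-norm of a face centre of `√2 ℤ²`, bounded below through the first lattice coordinate.
(Grimmett–Manolescu 2014, §2.1; elementary.) [folklore] -/
theorem le_boxNorm_squareLattice_c {f : Site 2} {t : ℝ} (h0 : t ≤ |(f 0 : ℝ) + 1 / 2|) :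
    Real.sqrt 2 * t ≤ (squareLatticeEmbedding.c f).boxNorm := by
  have hre : (squareLatticeEmbedding.c f).re = Real.sqrt 2 * ((f 0 : ℝ) + 1 / 2) := by
    rw [squareLatticeEmbedding_c]
    simp [Complex.mul_re, Complex.div_ofNat_re, Complex.div_ofNat_im]
  simp only [Complex.boxNorm, hre, abs_mul, abs_of_nonneg (Real.sqrt_nonneg 2)]
  exact le_max_of_le_left (mul_le_mul_of_nonneg_left h0 (Real.sqrt_nonneg 2))

/-- In the open dual graph of the isoradial square lattice, the faces with lower-left corners
`(a, k)` and `(a - 1, k)` are joined as soon as the vertical primal edge `{(a, k), (a, k + 1)}`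
between them is closed; here closedness is guaranteed by an invariant of the configuration
(all open edges have endpoints with first coordinate `≥ 1`) and `a ≤ 0`. (Grimmett 1999,
§11.2, "dual edge open iff primal edge closed"; Grimmett–Manolescu 2014, §2.2, open* paths;
face bookkeeping `squareLeftFace_north` / `squareLeftFace_south`.) [folklore] -/
theorem squareLattice_dualOpenGraph_adj_west {ω : BondConfig (Site 2)}
    (hω : ∀ e ∈ ω, ∀ u ∈ e, (1 : ℤ) ≤ u 0) {a : ℤ} (ha : a ≤ 0) (k : ℤ) :
    (squareLatticeEmbedding.dualOpenGraph ω).Adj ![a, k] ![a - 1, k] := by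
  have hadj : (zdGraph 2).Adj ![a, k] (![a, k] + Pi.single 1 1) :=
    (zdGraph_adj_iff _ _).2 ⟨1, Or.inl rfl⟩
  let d : (zdGraph 2).Dart := ⟨(![a, k], ![a, k] + Pi.single 1 1), hadj⟩
  have hsub : (![a, k] : Site 2) - Pi.single 0 1 = ![a - 1, k] := by
    ext i; fin_cases i <;> simp
  rw [RhombicEmbedding.dualOpenGraph, SimpleGraph.fromRel_adj]
  refine ⟨?_, Or.inr ⟨d, ?_, ?_, ?_⟩⟩
  · intro h
    have := congr_fun h 0
    simp at this
    omega
  · rw [squareLatticeEmbedding_leftFace, ← hsub]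
    exact squareLeftFace_north _
  · rw [squareLatticeEmbedding_rightFace]
    exact squareLeftFace_south _
  · intro hmem
    have h1 := hω _ hmem ![a, k] (Sym2.mem_mk_left _ _)
    simp at h1
    omega

/-- From "every open edge lies in the open cluster of `x₀`" to "any two open crossings of an
annulus start in the same open cluster": an open walk from sup-norm `≤ r` to sup-norm `≥ R > r`
has an edge, whose first endpoint is then joined to `x₀`. (Elementary; this is the form in
which a single-cluster configuration fails Grimmett–Manolescu's `A_{2j}(N, n)`, `j ≥ 2`, whose
primal arms are separated by dual arms inside the annulus, §3 and §8.2.) [folklore] -/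
theorem reachable_of_crossings_of_cluster {ω : BondConfig (Site 2)} {x₀ : Site 2}
    (hω : ∀ e ∈ ω, ∀ u ∈ e, (openGraph ω).Reachable x₀ u) {z : Site 2 → ℂ} {r R : ℝ}
    (hrR : r < R) {x y x' y' : Site 2} (p : (openGraph ω).Walk x y)
    (p' : (openGraph ω).Walk x' y') (hx : (z x).boxNorm ≤ r) (hy : R ≤ (z y).boxNorm)
    (hx' : (z x').boxNorm ≤ r) (hy' : R ≤ (z y').boxNorm) : (openGraph ω).Reachable x x' := by
  have key : ∀ {a b : Site 2} (q : (openGraph ω).Walk a b), (z a).boxNorm ≤ r →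
      R ≤ (z b).boxNorm → (openGraph ω).Reachable x₀ a := by
    intro a b q ha hb
    cases q with
    | nil => exact absurd (ha.trans_lt (hrR.trans_le hb)) (lt_irrefl _)
    | cons hadj _ => exact hω _ ((openGraph_adj _ _ _).1 hadj).1 a (Sym2.mem_mk_left _ _)
  exact (key p hx hy).symm.trans (key p' hx' hy')

/-- The *ladder* configuration on `ℤ²`: open edges `(1,0)–(2,0)–(3,0)`, `(1,1)–(2,1)–(3,1)` and
the rung `(2,0)–(2,1)`, every other edge closed — the explicit witness for D1 (one open cluster
carrying two vertex-disjoint open crossings, with two vertex-disjoint dual-open crossings west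
of it). (Elementary; the configuration behind
`exists_mem_embArmEvent_alternatingColours_two_of_connected`.) [folklore] -/
def ladderConfig : BondConfig (Site 2) :=
  {s(![1, 0], ![2, 0]), s(![2, 0], ![3, 0]), s(![1, 1], ![2, 1]), s(![2, 1], ![3, 1]),
    s(![2, 0], ![2, 1])}

/-- The endpoints of the open edges of the ladder have first coordinate in `[1, 3]` and second
coordinate in `[0, 1]`. [folklore] -/
theorem ladderConfig_coord : ∀ e ∈ ladderConfig, ∀ u ∈ e,
    (1 : ℤ) ≤ u 0 ∧ u 0 ≤ 3 ∧ (0 : ℤ) ≤ u 1 ∧ u 1 ≤ 1 := by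
  intro e he u hu
  simp only [ladderConfig, Set.mem_insert_iff, Set.mem_singleton_iff] at he
  rcases he with rfl | rfl | rfl | rfl | rfl <;>
    rcases Sym2.mem_iff.1 hu with rfl | rfl <;> simp

/-- Every open edge of the ladder lies east of `x = 1` (the invariant that makes all edges west
of `x = 1` closed, i.e. dual-open). [folklore] -/
theorem ladderConfig_fst : ∀ e ∈ ladderConfig, ∀ u ∈ e, (1 : ℤ) ≤ u 0 :=
  fun e he u hu => (ladderConfig_coord e he u hu).1

/-- **(a) One open cluster.** Every open edge of the ladder lies in the open cluster of `(1,0)`.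
[folklore] -/
theorem ladderConfig_reachable :
    ∀ e ∈ ladderConfig, ∀ u ∈ e, (openGraph ladderConfig).Reachable ![1, 0] u := by
  -- distinctness of lattice points through one coordinate
  have hne0 : ∀ {u v : Site 2}, u 0 ≠ v 0 → u ≠ v := fun h huv => h (congr_fun huv 0)
  have hne1 : ∀ {u v : Site 2}, u 1 ≠ v 1 → u ≠ v := fun h huv => h (congr_fun huv 1)
  have a1 : (openGraph ladderConfig).Adj ![1, 0] ![2, 0] :=
    (openGraph_adj _ _ _).2 ⟨by simp [ladderConfig], hne0 (by simp)⟩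
  have a2 : (openGraph ladderConfig).Adj ![2, 0] ![3, 0] :=
    (openGraph_adj _ _ _).2 ⟨by simp [ladderConfig], hne0 (by simp)⟩
  have a3 : (openGraph ladderConfig).Adj ![1, 1] ![2, 1] :=
    (openGraph_adj _ _ _).2 ⟨by simp [ladderConfig], hne0 (by simp)⟩
  have a4 : (openGraph ladderConfig).Adj ![2, 1] ![3, 1] :=
    (openGraph_adj _ _ _).2 ⟨by simp [ladderConfig], hne0 (by simp)⟩
  have a5 : (openGraph ladderConfig).Adj ![2, 0] ![2, 1] :=
    (openGraph_adj _ _ _).2 ⟨by simp [ladderConfig], hne1 (by simp)⟩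
  have r20 := a1.reachable
  have r30 := a1.reachable.trans a2.reachable
  have r21 := a1.reachable.trans a5.reachable
  have r11 := r21.trans a3.symm.reachable
  have r31 := r21.trans a4.reachable
  intro e he u hu
  simp only [ladderConfig, Set.mem_insert_iff, Set.mem_singleton_iff] at he
  rcases he with rfl | rfl | rfl | rfl | rfl <;>
    rcases Sym2.mem_iff.1 hu with rfl | rfl <;>
    first | exact SimpleGraph.Reachable.refl _ | assumption

/-- **(b) The ladder lies in the H21 event `embArmEvent (alternatingColours 2) 2 3`** on the
isoradial square lattice `squareLatticeEmbedding` (`√2 ℤ²`, faces indexed by lower-left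
corners): the two rails are vertex-disjoint primal open walks from `Λ_2` to `∂Λ_3` inside
`Λ_5 ∖ Λ_0`, and the face rows `(-1,0),(-2,0),(-3,0)` and `(-1,-1),(-2,-1),(-3,-1)` carry
vertex-disjoint dual open walks likewise (every edge west of `x = 1` is closed). No cyclic
order is asked for by `embArmEvent`, and indeed here the pattern is primal, primal, dual, dual.
(Grimmett–Manolescu 2014, §3, arm events; H21 rendering `embArmEvent`.)
[cite: GrimmettManolescu2014Isoradial, §3 (arm events A_σ, "in anticlockwise order"; A_{2j})] -/
theorem ladderConfig_mem_embArmEvent :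
    ladderConfig ∈ squareLatticeEmbedding.embArmEvent (alternatingColours 2) 2 3 := by
  -- two numerical constants
  have hs₁ : (7 / 5 : ℝ) ≤ Real.sqrt 2 := Real.le_sqrt_of_sq_le (by norm_num)
  have hs₂ : Real.sqrt 2 ≤ 3 / 2 := Real.sqrt_two_lt_three_halves.le
  -- distinctness of lattice points through one coordinate
  have hne0 : ∀ {u v : Site 2}, u 0 ≠ v 0 → u ≠ v := fun h huv => h (congr_fun huv 0)
  -- invariant: every open edge has both endpoints with first coordinate ≥ 1
  have hω : ∀ e ∈ ladderConfig, ∀ u ∈ e, (1 : ℤ) ≤ u 0 := ladderConfig_fst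
  -- the row index of arm `m : Fin 4` is `m / 2 ∈ {0, 1}` (integer division in `ℤ`)
  have hrow : ∀ m : Fin 4, ((m : ℕ) : ℤ) / 2 = 0 ∨ ((m : ℕ) : ℤ) / 2 = 1 := by
    intro m; have := m.2; omega
  -- primal adjacencies along the rows `y = m / 2`
  have hp1 : ∀ m : Fin 4, (openGraph ladderConfig).Adj
      ![1, ((m : ℕ) : ℤ) / 2] ![2, ((m : ℕ) : ℤ) / 2] := by
    intro m
    refine (openGraph_adj _ _ _).2 ⟨?_, hne0 (by simp)⟩
    rcases hrow m with h | h <;> simp [h, ladderConfig]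
  have hp2 : ∀ m : Fin 4, (openGraph ladderConfig).Adj
      ![2, ((m : ℕ) : ℤ) / 2] ![3, ((m : ℕ) : ℤ) / 2] := by
    intro m
    refine (openGraph_adj _ _ _).2 ⟨?_, hne0 (by simp)⟩
    rcases hrow m with h | h <;> simp [h, ladderConfig]
  -- dual adjacencies along the face rows `y = -(m / 2)`, west of `x = 0`
  have hd1 : ∀ m : Fin 4, (squareLatticeEmbedding.dualOpenGraph ladderConfig).Adj
      ![-1, -(((m : ℕ) : ℤ) / 2)] ![-1 - 1, -(((m : ℕ) : ℤ) / 2)] :=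
    fun m => squareLattice_dualOpenGraph_adj_west hω (by norm_num) _
  have hd2 : ∀ m : Fin 4, (squareLatticeEmbedding.dualOpenGraph ladderConfig).Adj
      ![-1 - 1, -(((m : ℕ) : ℤ) / 2)] ![-1 - 1 - 1, -(((m : ℕ) : ℤ) / 2)] :=
    fun m => squareLattice_dualOpenGraph_adj_west hω (by norm_num) _
  simp only [RhombicEmbedding.embArmEvent, Set.mem_setOf_eq]
  refine ⟨fun m => ![1, ((m : ℕ) : ℤ) / 2], fun m => ![3, ((m : ℕ) : ℤ) / 2],
    fun m => SimpleGraph.Walk.cons (hp1 m) (SimpleGraph.Walk.cons (hp2 m) SimpleGraph.Walk.nil),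
    fun m => ![-1, -(((m : ℕ) : ℤ) / 2)], fun m => ![-1 - 1 - 1, -(((m : ℕ) : ℤ) / 2)],
    fun m => SimpleGraph.Walk.cons (hd1 m) (SimpleGraph.Walk.cons (hd2 m) SimpleGraph.Walk.nil),
    ?_, ?_, ?_, ?_⟩
  · -- primal arms: from `Λ_2` to `∂Λ_3` inside `Λ_5 ∖ Λ_0`
    intro m _
    have hk : |((((m : ℕ) : ℤ) / 2 : ℤ) : ℝ)| ≤ 1 := by
      rcases hrow m with h | h <;> simp [h]
    refine ⟨?_, ?_, ?_⟩
    · have h := boxNorm_squareLattice_z_le (x := ![1, ((m : ℕ) : ℤ) / 2]) (t := 1)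
        (by simp) (by simpa using hk)
      have h' : (squareLatticeEmbedding.z ![1, ((m : ℕ) : ℤ) / 2]).boxNorm ≤ 2 := by linarith
      exact_mod_cast h'
    · have h := le_boxNorm_squareLattice_z (x := ![3, ((m : ℕ) : ℤ) / 2]) (t := 3) (by simp)
      have h' : 3 ≤ (squareLatticeEmbedding.z ![3, ((m : ℕ) : ℤ) / 2]).boxNorm := by linarith
      exact_mod_cast h'
    · intro v hv
      simp only [SimpleGraph.Walk.support_cons, SimpleGraph.Walk.support_nil,
        List.mem_cons, List.not_mem_nil, or_false] at hv
      have hv1 : |((v 1 : ℤ) : ℝ)| ≤ 3 := by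
        rcases hv with rfl | rfl | rfl <;> simpa using hk.trans (by norm_num)
      have hv0 : |((v 0 : ℤ) : ℝ)| ≤ 3 := by
        rcases hv with rfl | rfl | rfl <;> norm_num
      have h := boxNorm_squareLattice_z_le hv0 hv1
      constructor
      · exact_mod_cast (show ((2 : ℕ) : ℝ) - 2 ≤ (squareLatticeEmbedding.z v).boxNorm from
          le_trans (by norm_num) (le_max_of_le_left (abs_nonneg _)))
      · have h' : (squareLatticeEmbedding.z v).boxNorm ≤ 3 + 2 := by linarith
        exact_mod_cast h'
  · -- dual arms: faces `(-1, k), (-2, k), (-3, k)` with `k = -(m / 2)`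
    intro m _
    have hk : |(-((((m : ℕ) : ℤ) / 2 : ℤ) : ℝ)) + 1 / 2| ≤ 1 / 2 := by
      rcases hrow m with h | h <;> norm_num [h]
    refine ⟨?_, ?_, ?_⟩
    · have h := boxNorm_squareLattice_c_le (f := ![-1, -(((m : ℕ) : ℤ) / 2)]) (t := 1 / 2)
        (by norm_num) (by simpa using hk)
      have h' : (squareLatticeEmbedding.c ![-1, -(((m : ℕ) : ℤ) / 2)]).boxNorm ≤ 2 := by
        linarith
      exact_mod_cast h'
    · have h := le_boxNorm_squareLattice_c (f := ![-1 - 1 - 1, -(((m : ℕ) : ℤ) / 2)])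
        (t := 5 / 2) (by norm_num)
      have h' : 3 ≤ (squareLatticeEmbedding.c ![-1 - 1 - 1, -(((m : ℕ) : ℤ) / 2)]).boxNorm := by
        linarith
      exact_mod_cast h'
    · intro v hv
      simp only [SimpleGraph.Walk.support_cons, SimpleGraph.Walk.support_nil,
        List.mem_cons, List.not_mem_nil, or_false] at hv
      have hv1 : |((v 1 : ℤ) : ℝ) + 1 / 2| ≤ 5 / 2 := by
        rcases hv with rfl | rfl | rfl <;> simpa using hk.trans (by norm_num)
      have hv0 : |((v 0 : ℤ) : ℝ) + 1 / 2| ≤ 5 / 2 := by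
        rcases hv with rfl | rfl | rfl <;> norm_num
      have h := boxNorm_squareLattice_c_le hv0 hv1
      constructor
      · exact_mod_cast (show ((2 : ℕ) : ℝ) - 2 ≤ (squareLatticeEmbedding.c v).boxNorm from
          le_trans (by norm_num) (le_max_of_le_left (abs_nonneg _)))
      · have h' : (squareLatticeEmbedding.c v).boxNorm ≤ 3 + 2 := by linarith
        exact_mod_cast h'
  · -- the two primal arms (indices `0` and `2`) are vertex-disjoint: rows `0` and `1`
    intro i j hij hi hj
    simp only [alternatingColours, decide_eq_true_eq] at hi hj
    have hrow_ne : ((i : ℕ) : ℤ) / 2 ≠ ((j : ℕ) : ℤ) / 2 := by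
      intro h
      apply hij
      apply Fin.ext
      rcases hi with ⟨a, ha⟩; rcases hj with ⟨b, hb⟩; omega
    refine Set.disjoint_left.2 fun v hv hv' => hrow_ne ?_
    simp only [Set.mem_setOf_eq, SimpleGraph.Walk.support_cons, SimpleGraph.Walk.support_nil,
      List.mem_cons, List.not_mem_nil, or_false] at hv hv'
    have h1 : v 1 = ((i : ℕ) : ℤ) / 2 := by rcases hv with rfl | rfl | rfl <;> simp
    have h2 : v 1 = ((j : ℕ) : ℤ) / 2 := by rcases hv' with rfl | rfl | rfl <;> simp
    exact h1.symm.trans h2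
  · -- the two dual arms (indices `1` and `3`) are vertex-disjoint: face rows `0` and `-1`
    intro i j hij hi hj
    simp only [alternatingColours, decide_eq_false_iff_not, Nat.not_even_iff_odd] at hi hj
    have hrow_ne : ((i : ℕ) : ℤ) / 2 ≠ ((j : ℕ) : ℤ) / 2 := by
      intro h
      apply hij
      apply Fin.ext
      rcases hi with ⟨a, ha⟩; rcases hj with ⟨b, hb⟩; omega
    refine Set.disjoint_left.2 fun v hv hv' => hrow_ne ?_
    simp only [Set.mem_setOf_eq, SimpleGraph.Walk.support_cons, SimpleGraph.Walk.support_nil,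
      List.mem_cons, List.not_mem_nil, or_false] at hv hv'
    have h1 : v 1 = -(((i : ℕ) : ℤ) / 2) := by rcases hv with rfl | rfl | rfl <;> simp
    have h2 : v 1 = -(((j : ℕ) : ℤ) / 2) := by rcases hv' with rfl | rfl | rfl <;> simp
    have := h1.symm.trans h2
    omega

/-- **D1 made concrete: the H21 "alternating" four-arm event on a single open cluster.** On the
isoradial square lattice `squareLatticeEmbedding` (`√2 ℤ²`, faces indexed by lower-left
corners) the *ladder* configuration `ω` (`ladderConfig`) — open edges `(1,0)–(2,0)–(3,0)`,
`(1,1)–(2,1)–(3,1)` and the rung `(2,0)–(2,1)`, all other edges closed — satisfies: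
(a) every open edge lies in the open cluster of `(1,0)` (one open cluster), and yet
(b) `ω ∈ embArmEvent (alternatingColours 2) 2 3`: the two rails are vertex-disjoint primal
open walks from `Λ_2` to `∂Λ_3` inside `Λ_5 ∖ Λ_0`, and the face rows `(-1,0),(-2,0),(-3,0)`
and `(-1,-1),(-2,-1),(-3,-1)` carry vertex-disjoint dual open walks likewise (every edge west
of `x = 1` is closed). In Grimmett–Manolescu's alternating event `A_4(N, n)` (§3: four
crossings of alternating colours *in anticlockwise order*) the two primal arms are separated by
the two dual arms and hence lie in distinct open clusters of the annulus (the form `Ã_4` of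
§8.2: `x_1 ↮ x_2`), which (a) forbids for every annulus (`…_crossings_connected`). So the event
used by the original transcription of `gm_universality_arms` for `j = 2` is not the source's
`A_4`: it also contains the polychromatic pattern primal-primal-dual-dual. (Grimmett–Manolescu 2014, §3, arm events and
Theorem "Universality" (a); §8.2.)
[cite: GrimmettManolescu2014Isoradial, §3 (arm events A_σ, "in anticlockwise order"; A_{2j}); §8.2 (Ã_{2j})] -/
theorem exists_mem_embArmEvent_alternatingColours_two_of_connected :
    ∃ ω : BondConfig (Site 2),
      (∀ e ∈ ω, ∀ u ∈ e, (openGraph ω).Reachable ![1, 0] u) ∧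
      ω ∈ squareLatticeEmbedding.embArmEvent (alternatingColours 2) 2 3 :=
  ⟨ladderConfig, ladderConfig_reachable, ladderConfig_mem_embArmEvent⟩

/-- **Corollary (the form that contradicts `A_4`).** For the ladder configuration of
`exists_mem_embArmEvent_alternatingColours_two_of_connected`: it lies in the H21 event
`embArmEvent (alternatingColours 2) 2 3`, and for *every* drawing `z` and all radii `r < R`
any two open crossings from `{‖z‖_∞ ≤ r}` to `{R ≤ ‖z‖_∞}` start in the same open cluster —
whereas the primal arms of Grimmett–Manolescu's alternating event are pairwise separated by
dual arms (§3; §8.2, `x_i ↮ x_{i'}`). Hence `embArmEvent (alternatingColours j)`, `j ≥ 2`, is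
not a rendering of `A_{2j}`, and the hypothesis and conclusion of the original transcription of
`gm_universality_arms` for `j ≥ 2` concerned an event outside the scope of the source's
Theorem "Universality" (a) (whence its restatement with `embAltArmEvent`).
(Grimmett–Manolescu 2014, §3 and §8.2.)
[cite: GrimmettManolescu2014Isoradial, §3 (A_{2j}, alternating in anticlockwise order); §8.2 (Ã_{2j}: x_i ↮ x_{i'})] -/
theorem exists_mem_embArmEvent_alternatingColours_two_crossings_connected :
    ∃ ω : BondConfig (Site 2),
      ω ∈ squareLatticeEmbedding.embArmEvent (alternatingColours 2) 2 3 ∧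
      ∀ (z : Site 2 → ℂ) (r R : ℝ), r < R → ∀ (x y x' y' : Site 2)
        (_ : (openGraph ω).Walk x y) (_ : (openGraph ω).Walk x' y'),
        (z x).boxNorm ≤ r → R ≤ (z y).boxNorm → (z x').boxNorm ≤ r → R ≤ (z y').boxNorm →
        (openGraph ω).Reachable x x' := by
  obtain ⟨ω, hω, hmem⟩ := exists_mem_embArmEvent_alternatingColours_two_of_connected
  exact ⟨ω, hmem, fun z r R hrR x y x' y' p p' hx hy hx' hy' =>
    reachable_of_crossings_of_cluster hω hrR p p' hx hy hx' hy'⟩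

end Witness

/-! ### The corrected event versus the H21 event: equal at `j = 1` -/

section AltOne

variable {V F : Type*} {G : SimpleGraph V} (emb : RhombicEmbedding G F)

/-- **At `j = 1` the corrected event is the prelude's event.** For every rhombic embedding and all
radii, `embAltArmEvent 1 r R = embArmEvent (alternatingColours 1) r R`: both say "one open
crossing and one dual-open crossing of `Λ_R ∖ Λ_r`, each drawn in `{r - 2 ≤ ‖·‖_∞ ≤ R + 2}`"
(walks with constrained support on one side, reachability in the induced open / dual-open graph
of the annulus on the other, bridged by `mem_openConnIn_iff_exists_openWalk` and
`dualConnIn_iff_exists_walk`); the separation clauses of `embAltArmEvent` and the disjointness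
clauses of `embArmEvent` are vacuous for a single arm of each kind — two arms of different
kinds are automatically "alternating in anticlockwise order". The inclusion `⊆` is the general
`embAltArmEvent_subset_embArmEvent`. (Grimmett–Manolescu 2014, §3: `A_2(N, n)`, the alternating
arm event of length `2`; bookkeeping between the tree's two renderings.)
[cite: GrimmettManolescu2014Isoradial, §3 (arm events A_σ; A_{2j} with j = 1)] -/
theorem _root_.Literature.Probability.LatticeModels.RhombicEmbedding.embAltArmEvent_one_eq
    (r R : ℕ) : emb.embAltArmEvent 1 r R = emb.embArmEvent (alternatingColours 1) r R := by
  refine Set.Subset.antisymm (emb.embAltArmEvent_subset_embArmEvent 1 r R) ?_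
  rintro ω ⟨x, y, w, f, g, w', hP, hD, -, -⟩
  obtain ⟨hx, hy, hw⟩ := hP ⟨0, by norm_num⟩ (by simp [alternatingColours])
  obtain ⟨hf, hg, hw'⟩ := hD ⟨1, by norm_num⟩ (by simp [alternatingColours])
  refine ⟨⟨fun _ => x ⟨0, by norm_num⟩, fun _ => y ⟨0, by norm_num⟩, fun _ => ⟨hx, hy, ?_⟩, ?_⟩,
    ⟨fun _ => f ⟨1, by norm_num⟩, fun _ => g ⟨1, by norm_num⟩, fun _ => ⟨hf, hg, ?_⟩, ?_⟩⟩
  · exact mem_openConnIn_iff_exists_openWalk.2 ⟨w _, fun v hv => hw v hv⟩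
  · exact fun i i' h => absurd (Subsingleton.elim i i') h
  · exact (emb.dualConnIn_iff_exists_walk ω _ _ _).2 ⟨w' _, fun v hv => hw' v hv⟩
  · exact fun i i' h => absurd (Subsingleton.elim i i') h

end AltOne

/-! ### The corrected event versus the H21 event: strictly smaller at `j = 2` (D1) -/

section WitnessAlt

open RhombicEmbedding

/-- An open walk starting in `S` stays in `S` as soon as every open edge has both endpoints in
`S`. (Elementary bookkeeping on `Walk.support`.) [folklore] -/
theorem forall_mem_support_of_forall_mem_edge {V : Type*} {ω : BondConfig V} {S : Set V}
    (hS : ∀ e ∈ ω, ∀ u ∈ e, u ∈ S) {x y : V} (p : (openGraph ω).Walk x y) (hx : x ∈ S) :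
    ∀ v ∈ p.support, v ∈ S := by
  induction p with
  | nil => simpa using hx
  | @cons a b c hadj q ih =>
    intro v hv
    rw [SimpleGraph.Walk.support_cons, List.mem_cons] at hv
    rcases hv with rfl | hv
    · exact hx
    · exact ih (hS _ ((openGraph_adj _ _ _).1 hadj).1 b (Sym2.mem_mk_right _ _)) v hv

/-- A vertex of `√2 ℤ²` with both lattice coordinates of absolute value `≤ 3` is drawn in the
slackened annulus `{0 ≤ ‖·‖_∞ ≤ 5}` of `annulusPts squareLatticeEmbedding.z 2 3`
(`‖z v‖_∞ ≤ 3 √2 < 5`). (Elementary.) [folklore] -/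
theorem mem_annulusPts_squareLattice_two_three {v : Site 2} (h0 : |(v 0 : ℝ)| ≤ 3)
    (h1 : |(v 1 : ℝ)| ≤ 3) : v ∈ annulusPts squareLatticeEmbedding.z 2 3 := by
  have hs₂ : Real.sqrt 2 ≤ 3 / 2 := Real.sqrt_two_lt_three_halves.le
  have h := boxNorm_squareLattice_z_le h0 h1
  rw [mem_annulusPts]
  constructor
  · exact_mod_cast (show ((2 : ℕ) : ℝ) - 2 ≤ (squareLatticeEmbedding.z v).boxNorm from
      le_trans (by norm_num) (le_max_of_le_left (abs_nonneg _)))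
  · have h' : (squareLatticeEmbedding.z v).boxNorm ≤ 3 + 2 := by linarith
    exact_mod_cast h'

/-- Every open edge of the ladder has both endpoints in the slackened annulus of
`annulusPts squareLatticeEmbedding.z 2 3`. [folklore] -/
theorem ladderConfig_subset_annulusPts :
    ∀ e ∈ ladderConfig, ∀ u ∈ e, u ∈ annulusPts squareLatticeEmbedding.z 2 3 := by
  intro e he u hu
  obtain ⟨h0, h0', h1, h1'⟩ := ladderConfig_coord e he u hu
  refine mem_annulusPts_squareLattice_two_three ?_ ?_
  · rw [abs_le]; constructor <;> linarith [(by exact_mod_cast h0 : (1 : ℝ) ≤ u 0),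
      (by exact_mod_cast h0' : (u 0 : ℝ) ≤ 3)]
  · rw [abs_le]; constructor <;> linarith [(by exact_mod_cast h1 : (0 : ℝ) ≤ u 1),
      (by exact_mod_cast h1' : (u 1 : ℝ) ≤ 1)]

/-- **The ladder is not in the corrected event `embAltArmEvent 2 2 3`.** Two open crossings of
the annulus `Λ_3 ∖ Λ_2` of `√2 ℤ²` in the ladder configuration start at endpoints of open
edges, hence in the open cluster of `(1,0)` (`ladderConfig_reachable`), and every open path of
the ladder runs inside the slackened annulus (`ladderConfig_subset_annulusPts`); so the two
crossings are joined *inside the annulus*, contradicting the separation clause `x_0 ↮ x_1` of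
`embAltArmEvent` (Grimmett–Manolescu's `Ã_4`: "`x_i ↮ x_{i'}` for `i ≠ i'`", §8.2; equivalently
the anticlockwise alternation of `A_4`, §3). (Grimmett–Manolescu 2014, §3 and §8.2.)
[cite: GrimmettManolescu2014Isoradial, §3 (A_{2j}, alternating in anticlockwise order); §8.2 (Ã_{2j}: x_i ↮ x_{i'})] -/
theorem ladderConfig_not_mem_embAltArmEvent :
    ladderConfig ∉ squareLatticeEmbedding.embAltArmEvent 2 2 3 := by
  rintro ⟨⟨x, y, hxy, hsep⟩, -⟩
  obtain ⟨hx0, hy0, hc0⟩ := hxy 0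
  obtain ⟨hx1, hy1, hc1⟩ := hxy 1
  obtain ⟨w0, hw0⟩ := mem_openConnIn_iff_exists_openWalk.1 hc0
  obtain ⟨w1, hw1⟩ := mem_openConnIn_iff_exists_openWalk.1 hc1
  have hreach : (openGraph ladderConfig).Reachable (x 0) (x 1) :=
    reachable_of_crossings_of_cluster ladderConfig_reachable (by norm_num) w0 w1 hx0 hy0 hx1 hy1
  obtain ⟨p⟩ := hreach
  exact hsep (show (0 : Fin 2) ≠ 1 by decide) (mem_openConnIn_iff_exists_openWalk.2
    ⟨p, forall_mem_support_of_forall_mem_edge ladderConfig_subset_annulusPts p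
      (hw0 _ w0.start_mem_support)⟩)

/-- **D1 as a strict inclusion between the tree's two events.** On the isoradial square
lattice (a member of the class `𝒢`), the corrected alternating four-arm event
`embAltArmEvent 2 2 3` is a *strict* subset of the prelude's event `embArmEvent
(alternatingColours 2) 2 3` hypothesised by the original transcription of `gm_universality_arms`
at `j = 2`: the inclusion is `embAltArmEvent_subset_embArmEvent`, and the ladder configuration
separates them (`ladderConfig_mem_embArmEvent`, `ladderConfig_not_mem_embAltArmEvent`). Hence
the hypothesis and the conclusion of that transcription for `j = 2` concerned a strictly larger
event than the (rendering of the) alternating arm event `A_4` of the source's Theorem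
"Universality" (a); the restated fact uses `embAltArmEvent`.
(Grimmett–Manolescu 2014, §3 and §8.2.)
[cite: GrimmettManolescu2014Isoradial, §3 (A_σ "in anticlockwise order"; Theorem "Universality" (a) for ρ_{2j}); §8.2] -/
theorem embAltArmEvent_two_ssubset_embArmEvent :
    squareLatticeEmbedding.embAltArmEvent 2 2 3 ⊂
      squareLatticeEmbedding.embArmEvent (alternatingColours 2) 2 3 := by
  refine (Set.ssubset_iff_of_subset
    (squareLatticeEmbedding.embAltArmEvent_subset_embArmEvent 2 2 3)).2 ?_
  exact ⟨ladderConfig, ladderConfig_mem_embArmEvent, ladderConfig_not_mem_embAltArmEvent⟩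

end WitnessAlt

end Literature.Probability.Percolation
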